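import Literature.NumberTheory.DiophantineGeometry.FibreConductorCritJunction
import Literature.NumberTheory.DiophantineGeometry.GenEllDeFamilyBadPrimes
import Literature.NumberTheory.DiophantineGeometry.FibreConductorKappaMixed
import HarnessLib

/-!
# [GenEll] Thm. 2.1 on the `D_e` route, family `t_c`: the conductor slope with SEPARATION AT 2 ONLY

S. Mochizuki, *Arithmetic elliptic curves in general position*, Math. J. Okayama Univ. 52 (2010),
Prop. 1.6 p. 10 (conductor of the reduced fibre divisor bounded by the height) as used in the proof of
Thm. 2.1 pp. 12–13 [cite: MochizukiGenEll2010, Prop 1.6 p.10]. Support file for the route item `GenEllTwo`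
(ledger `stmt-ABC-19679`); classical, nothing here bears on [IUTchIII] Cor. 3.12.

This is the «R-b WITH DEFECTS» twin (GenEllTwo owner ruling #7, 2026-08-26: separation place set
`{∞, 2}` exactly) of `DeC.slope_of_crit_off_badPrimes` (`GenEllDeFamilySlopeOffBadPrimes.lean`,
abc-iut-w5-d045): the bad places are the places over a finite set `T ⊇ S(e, c, A) ∋ 2` of rational primes;
AT 2 the point is separated from the ramification locus in embedding currency
(`2^{−k₂} ≤ ‖σ N‖` for every `σ : L → ℚ̄₂`), at every OTHER prime `p ∈ T` only the defect inequality
`ord⁺_w(N) ≤ Σ_{b∈B} ord⁺_w(t − b) + D_p·e_w` is assumed (no separation), and off `T` the B-free good-place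
dichotomy of `DeC.ord_placewise_of_crit` (abc-iut-w5-d023) applies, its four placewise good-reduction
hypotheses being discharged by `DeC.exists_badPrimes` (abc-iut-w5-d045). The summation is
`FibreConductor.inv_finrank_mul_sum_logNorm_le_slope_of_prime_sep_of_prime_defect`
(`FibreConductorKappaMixed.lean`). Output: the `hκ` shape

  `(1/[L:ℚ]) Σ_{w∈W} log N(w) ≤ ((|B|(2k+4) − (6k+6))/(2k+1))·(1/[L:ℚ])·h_L(x)`
  `+ ((|B|·C₄ + C₅)/(2k+1) + |B|·(C₆ + log 2) + (k₂·log 2 + Σ_{p∈T∖{2}} D_p·log p) + (log 2 + Σ_{p∈T∖{2}} log p) + C₃)`.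

The primed variants (`…_sep_two_defect'`) take an ARBITRARY defect weight `D(w)` at the places over
`T ∖ {2}` with the single summed bound `Σ D(w)·log N(w) ≤ n·C₁` (so pole orders of non-integral critical
values and denominator orders can be charged to heights) instead of the per-prime form `D_p·e_w`.
No definitions.
-/

noncomputable section

namespace Literature.NumberTheory.DiophantineGeometry.GenEll

open _root_.Polynomial NumberField IsDedekindDomain
open Literature.IUT.LogVolume

universe u

section placewise

variable {L : Type*} [Field L] [NumberField L]

open scoped Classical in
/-- Membership in the bad set `⋃_{p∈T} placesOver L p` (indexed by `T.attach`), unfolded.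
[cite: MochizukiGenEll2010, Prop 1.6 p.10] -/
theorem mem_attach_biUnion_placesOver_iff (T : Finset ℕ) (w : HeightOneSpectrum (𝓞 L)) :
    w ∈ T.attach.biUnion (fun p => placesOver L p.1) ↔ ∃ p ∈ T, w ∈ placesOver L p := by
  constructor
  · intro h
    obtain ⟨p, -, hp⟩ := Finset.mem_biUnion.mp h
    exact ⟨p.1, p.2, hp⟩
  · rintro ⟨p, hpT, hw⟩
    exact Finset.mem_biUnion.mpr ⟨⟨p, hpT⟩, Finset.mem_attach _ _, hw⟩

open scoped Classical in
/-- For `2 ∈ T`: the places over `T` are the places over `{2}` together with the places over `T ∖ {2}`.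
[cite: MochizukiGenEll2010, Prop 1.6 p.10] -/
theorem mem_biUnion_two_union_erase_iff (T : Finset ℕ) (h2T : 2 ∈ T) (w : HeightOneSpectrum (𝓞 L)) :
    w ∈ ({2} : Finset ℕ).attach.biUnion (fun p => placesOver L p.1) ∪
        (T.erase 2).attach.biUnion (fun p => placesOver L p.1) ↔
      w ∈ T.attach.biUnion (fun p => placesOver L p.1) := by
  rw [Finset.mem_union, mem_attach_biUnion_placesOver_iff, mem_attach_biUnion_placesOver_iff,
    mem_attach_biUnion_placesOver_iff]
  constructor
  · rintro (⟨p, hp, hw⟩ | ⟨p, hp, hw⟩)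
    · rw [Finset.mem_singleton] at hp
      subst hp
      exact ⟨2, h2T, hw⟩
    · exact ⟨p, Finset.mem_of_mem_erase hp, hw⟩
  · rintro ⟨p, hp, hw⟩
    by_cases hp2 : p = 2
    · subst hp2
      exact Or.inl ⟨2, Finset.mem_singleton_self _, hw⟩
    · exact Or.inr ⟨p, Finset.mem_erase.mpr ⟨hp2, hp⟩, hw⟩

open scoped Classical in
/-- **The conductor slope for the family `t_c`, separation at 2 and defects elsewhere (placewise
hypotheses explicit).**  Twin of `DeC.inv_finrank_mul_sum_logNorm_le_slope_of_crit` with the bad set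
`Sbad := ⋃_{p∈T} placesOver L p` (`2 ∈ T`, `T` primes) and the bad-place inputs
`hsep2` (embedding-currency separation at 2), `hδ` (defect inequality at every `p ∈ T`, `p ≠ 2`)
in place of `hbad₁`/`hbad₂`. [cite: MochizukiGenEll2010, Prop 1.6 p.10] -/
theorem DeC.inv_finrank_mul_sum_logNorm_le_slope_of_crit_sep_two_defect (k : ℕ) {c r s t N x : L}
    (hcurve : s ^ 2 = 1 - 4 * r ^ (2 * k + 1)) (ht : t * (r * s) = s + c * r ^ (k + 2))
    (hN : N = -s ^ 3 + c * ((k + 1) * r ^ (k + 2) - 2 * r ^ (3 * k + 3))) (hN0 : N ≠ 0)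
    (A B : Finset L) (hAB : A ⊆ B) (htB : ∀ b ∈ B, t ≠ b) (g : L → L[X])
    (hg : ∀ a ∈ A, g a = C (c ^ 2) * X ^ (2 * k + 4) + C (4 * a ^ 2) * X ^ (2 * k + 3)
      - C (8 * a) * X ^ (2 * k + 2) + C 4 * X ^ (2 * k + 1) - C (a ^ 2) * X ^ 2 + C (2 * a) * X - 1)
    (T : Finset ℕ) (h2T : 2 ∈ T) (hT : ∀ p ∈ T, p.Prime) (W : Finset (HeightOneSpectrum (𝓞 L)))
    (k₂ : ℕ) (Dp : ℕ → ℕ) {C₃ C₄ C₅ C₆ : ℝ}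
    (h2 : ∀ w, w ∉ T.attach.biUnion (fun p => placesOver L p.1) → w.valuation L 2 = 1)
    (hc : ∀ w, w ∉ T.attach.biUnion (fun p => placesOver L p.1) → w.valuation L c = 1)
    (hAint : ∀ w, w ∉ T.attach.biUnion (fun p => placesOver L p.1) → ∀ a ∈ A, w.valuation L a ≤ 1)
    (hgapA : ∀ w, w ∉ T.attach.biUnion (fun p => placesOver L p.1) → ∀ a ∈ A, ∀ ρ : L,
      w.valuation L ρ ≤ 1 → (g a).eval ρ ≠ 0 → w.valuation L ((g a).eval ρ) < 1 →
      w.valuation L ((g a).eval ρ) < w.valuation L ((derivative (g a)).eval ρ))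
    (hconvA : ∀ w, w ∉ T.attach.biUnion (fun p => placesOver L p.1) →
      w.valuation L N < 1 → ∃ a ∈ A, w.valuation L (t - a) < 1)
    (hW : ∀ w ∈ W, w ∉ T.attach.biUnion (fun p => placesOver L p.1) → ∃ b ∈ B, 0 < ord L w (t - b))
    (hsep2 : ∀ σ : L →+* PadicAlgCl 2, ((2 : ℝ) ^ k₂)⁻¹ ≤ ‖σ N‖)
    (hδ : ∀ p ∈ T, p ≠ 2 → ∀ w ∈ placesOver L p,
      (ord L w N).toNat ≤ (∑ b ∈ B, (ord L w (t - b)).toNat) + Dp p * ramIdx L w)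
    (harch : ∀ v : InfinitePlace L, Real.posLog (v N⁻¹) ≤ C₃)
    (htH : (2 * k + 1 : ℝ) * Height.logHeight₁ t ≤
      (2 * k + 4 : ℝ) * Height.logHeight₁ x + Module.finrank ℚ L * C₄)
    (hNH : (6 * k + 6 : ℝ) * Height.logHeight₁ x ≤
      (2 * k + 1 : ℝ) * Height.logHeight₁ N + Module.finrank ℚ L * C₅)
    (hBH : ∀ b ∈ B, Height.logHeight₁ b ≤ Module.finrank ℚ L * C₆) :
    (Module.finrank ℚ L : ℝ)⁻¹ * ∑ w ∈ W, logNorm L w ≤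
      ((B.card * (2 * k + 4 : ℝ) - (6 * k + 6)) / (2 * k + 1)) *
          ((Module.finrank ℚ L : ℝ)⁻¹ * Height.logHeight₁ x) +
        ((B.card * C₄ + C₅) / (2 * k + 1) + B.card * (C₆ + Real.log 2) +
          ((k₂ : ℝ) * Real.log 2 + ∑ p ∈ T.erase 2, (Dp p : ℝ) * Real.log p) +
          (Real.log 2 + ∑ p ∈ T.erase 2, Real.log p) + C₃) := by
  have hoff : ∀ w : HeightOneSpectrum (𝓞 L),
      w ∉ ({2} : Finset ℕ).attach.biUnion (fun p => placesOver L p.1) ∪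
        (T.erase 2).attach.biUnion (fun p => placesOver L p.1) →
      w ∉ T.attach.biUnion (fun p => placesOver L p.1) :=
    fun w hw => (mem_biUnion_two_union_erase_iff T h2T w).not.mp hw
  have key := FibreConductor.inv_finrank_mul_sum_logNorm_le_slope_of_prime_sep_of_prime_defect
    k x t N hN0 B W {2} (T.erase 2) (fun p hp => by rw [Finset.mem_singleton.mp hp]; exact Nat.prime_two)
    (fun p hp => hT p (Finset.mem_of_mem_erase hp)) (fun _ => k₂) Dp (C₃ := C₃) (C₄ := C₄) (C₅ := C₅)
    (C₆ := C₆)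
    (fun w hw => DeC.ord_placewise_of_crit w k (h2 w (hoff w hw)) (hc w (hoff w hw)) hcurve ht hN hN0 A B
      hAB htB g hg (hAint w (hoff w hw)) (hgapA w (hoff w hw)) (hconvA w (hoff w hw)))
    (fun w hwW hw => hW w hwW (hoff w hw))
    (fun p hp _ σ => by
      have hp2 : p = 2 := Finset.mem_singleton.mp hp
      subst hp2
      exact_mod_cast hsep2 σ)
    (fun p hp w hw => hδ p (Finset.mem_of_mem_erase hp) (Finset.ne_of_mem_erase hp) w hw)
    harch htH hNH hBH
  simpa only [Finset.sum_singleton, Nat.cast_ofNat] using key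

open scoped Classical in
/-- **General-weight variant** of `DeC.inv_finrank_mul_sum_logNorm_le_slope_of_crit_sep_two_defect`: the
defect at the places over `T ∖ {2}` is an ARBITRARY weight `D(w)` (e.g. `ord⁺_w` of a fixed denominator
plus pole orders of the critical values) controlled only through the single summed bound
`Σ_{w over T∖{2}} D(w)·log N(w) ≤ n·C₁` (typically from heights: `Σ_w ord⁺_w(y)·log N(w) ≤ h_L(y)`).
[cite: MochizukiGenEll2010, Prop 1.6 p.10] -/
theorem DeC.inv_finrank_mul_sum_logNorm_le_slope_of_crit_sep_two_defect' (k : ℕ) {c r s t N x : L}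
    (hcurve : s ^ 2 = 1 - 4 * r ^ (2 * k + 1)) (ht : t * (r * s) = s + c * r ^ (k + 2))
    (hN : N = -s ^ 3 + c * ((k + 1) * r ^ (k + 2) - 2 * r ^ (3 * k + 3))) (hN0 : N ≠ 0)
    (A B : Finset L) (hAB : A ⊆ B) (htB : ∀ b ∈ B, t ≠ b) (g : L → L[X])
    (hg : ∀ a ∈ A, g a = C (c ^ 2) * X ^ (2 * k + 4) + C (4 * a ^ 2) * X ^ (2 * k + 3)
      - C (8 * a) * X ^ (2 * k + 2) + C 4 * X ^ (2 * k + 1) - C (a ^ 2) * X ^ 2 + C (2 * a) * X - 1)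
    (T : Finset ℕ) (h2T : 2 ∈ T) (hT : ∀ p ∈ T, p.Prime) (W : Finset (HeightOneSpectrum (𝓞 L)))
    (k₂ : ℕ) (D : HeightOneSpectrum (𝓞 L) → ℕ) {C₁ C₃ C₄ C₅ C₆ : ℝ}
    (h2 : ∀ w, w ∉ T.attach.biUnion (fun p => placesOver L p.1) → w.valuation L 2 = 1)
    (hc : ∀ w, w ∉ T.attach.biUnion (fun p => placesOver L p.1) → w.valuation L c = 1)
    (hAint : ∀ w, w ∉ T.attach.biUnion (fun p => placesOver L p.1) → ∀ a ∈ A, w.valuation L a ≤ 1)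
    (hgapA : ∀ w, w ∉ T.attach.biUnion (fun p => placesOver L p.1) → ∀ a ∈ A, ∀ ρ : L,
      w.valuation L ρ ≤ 1 → (g a).eval ρ ≠ 0 → w.valuation L ((g a).eval ρ) < 1 →
      w.valuation L ((g a).eval ρ) < w.valuation L ((derivative (g a)).eval ρ))
    (hconvA : ∀ w, w ∉ T.attach.biUnion (fun p => placesOver L p.1) →
      w.valuation L N < 1 → ∃ a ∈ A, w.valuation L (t - a) < 1)
    (hW : ∀ w ∈ W, w ∉ T.attach.biUnion (fun p => placesOver L p.1) → ∃ b ∈ B, 0 < ord L w (t - b))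
    (hsep2 : ∀ σ : L →+* PadicAlgCl 2, ((2 : ℝ) ^ k₂)⁻¹ ≤ ‖σ N‖)
    (hδ : ∀ p ∈ T, p ≠ 2 → ∀ w ∈ placesOver L p,
      (ord L w N).toNat ≤ (∑ b ∈ B, (ord L w (t - b)).toNat) + D w)
    (hD : ∑ w ∈ (T.erase 2).attach.biUnion (fun p => placesOver L p.1), (D w : ℝ) * logNorm L w ≤
      Module.finrank ℚ L * C₁)
    (harch : ∀ v : InfinitePlace L, Real.posLog (v N⁻¹) ≤ C₃)
    (htH : (2 * k + 1 : ℝ) * Height.logHeight₁ t ≤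
      (2 * k + 4 : ℝ) * Height.logHeight₁ x + Module.finrank ℚ L * C₄)
    (hNH : (6 * k + 6 : ℝ) * Height.logHeight₁ x ≤
      (2 * k + 1 : ℝ) * Height.logHeight₁ N + Module.finrank ℚ L * C₅)
    (hBH : ∀ b ∈ B, Height.logHeight₁ b ≤ Module.finrank ℚ L * C₆) :
    (Module.finrank ℚ L : ℝ)⁻¹ * ∑ w ∈ W, logNorm L w ≤
      ((B.card * (2 * k + 4 : ℝ) - (6 * k + 6)) / (2 * k + 1)) *
          ((Module.finrank ℚ L : ℝ)⁻¹ * Height.logHeight₁ x) +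
        ((B.card * C₄ + C₅) / (2 * k + 1) + B.card * (C₆ + Real.log 2) +
          ((k₂ : ℝ) * Real.log 2 + C₁) + (Real.log 2 + ∑ p ∈ T.erase 2, Real.log p) + C₃) := by
  set Ssep := ({2} : Finset ℕ).attach.biUnion (fun p => placesOver L p.1) with hSsep
  set Sdef := (T.erase 2).attach.biUnion (fun p => placesOver L p.1) with hSdef
  have hoff : ∀ w : HeightOneSpectrum (𝓞 L), w ∉ Ssep ∪ Sdef →
      w ∉ T.attach.biUnion (fun p => placesOver L p.1) :=
    fun w hw => (mem_biUnion_two_union_erase_iff T h2T w).not.mp hw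
  have h2p : ∀ p ∈ ({2} : Finset ℕ), p.Prime := fun p hp => by
    rw [Finset.mem_singleton.mp hp]; exact Nat.prime_two
  have hTp : ∀ p ∈ T.erase 2, p.Prime := fun p hp => hT p (Finset.mem_of_mem_erase hp)
  -- separation at 2, summed
  have hsep : ∑ w ∈ Ssep, ((ord L w N).toNat : ℝ) * logNorm L w ≤
      Module.finrank ℚ L * ((k₂ : ℝ) * Real.log 2) := by
    have h := FibreConductor.sum_biUnion_placesOver_toNat_ord_mul_logNorm_le ({2} : Finset ℕ) h2p hN0
      (fun _ => k₂) (fun p hp _ σ => by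
        have hp2 : p = 2 := Finset.mem_singleton.mp hp
        subst hp2
        exact_mod_cast hsep2 σ)
    simpa only [Finset.sum_singleton, Nat.cast_ofNat] using h
  -- the defect inequality at the places over `T ∖ {2}`
  have hdef : ∀ w ∈ Sdef, (ord L w N).toNat ≤ (∑ b ∈ B, (ord L w (t - b)).toNat) + D w := by
    intro w hw
    obtain ⟨p, hp, hwp⟩ := (mem_attach_biUnion_placesOver_iff (T.erase 2) w).mp hw
    exact hδ p (Finset.mem_of_mem_erase hp) (Finset.ne_of_mem_erase hp) w hwp
  -- the trivial conductor bound over `Ssep ∪ Sdef`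
  have hbad₂ : ∑ w ∈ Ssep ∪ Sdef, logNorm L w ≤
      Module.finrank ℚ L * (Real.log 2 + ∑ p ∈ T.erase 2, Real.log p) := by
    have hu : ∑ w ∈ Ssep ∪ Sdef, logNorm L w ≤ ∑ w ∈ Ssep, logNorm L w + ∑ w ∈ Sdef, logNorm L w := by
      have e := Finset.sum_union_inter (s₁ := Ssep) (s₂ := Sdef) (f := fun w => logNorm L w)
      have hnn : 0 ≤ ∑ w ∈ Ssep ∩ Sdef, logNorm L w :=
        Finset.sum_nonneg fun w _ => (logNorm_pos L w).le
      linarith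
    have h1 := FibreConductor.sum_biUnion_placesOver_logNorm_le (L := L) ({2} : Finset ℕ) h2p
    rw [Finset.sum_singleton, Nat.cast_ofNat] at h1
    have h2' := FibreConductor.sum_biUnion_placesOver_logNorm_le (L := L) (T.erase 2) hTp
    rw [mul_add]
    linarith
  have key := FibreConductor.inv_finrank_mul_sum_logNorm_le_slope_of_sep_of_defect k x t N B W Ssep Sdef
    D (C₁ := (k₂ : ℝ) * Real.log 2) (C₁' := C₁) (C₂ := Real.log 2 + ∑ p ∈ T.erase 2, Real.log p)
    (C₃ := C₃) (C₄ := C₄) (C₅ := C₅) (C₆ := C₆)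
    (fun w hw => DeC.ord_placewise_of_crit w k (h2 w (hoff w hw)) (hc w (hoff w hw)) hcurve ht hN hN0 A B
      hAB htB g hg (hAint w (hoff w hw)) (hgapA w (hoff w hw)) (hconvA w (hoff w hw)))
    (fun w hwW hw => hW w hwW (hoff w hw)) hsep hdef hD hbad₂ harch htH hNH hBH
  exact key

end placewise

variable {K : Type u} [Field K] [NumberField K]

open scoped Classical in
/-- **The conductor slope for the family `t_c` — separation at 2, defects at the other bad primes**
([GenEll] Prop. 1.6, sharp form on `D_e`, summed over all places; «R-b with defects»): for `k`
(`e = 2k+1`), `c ≠ 0` and the finite set `A` of critical values of `t_c` over a number field `K`, there is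
ONE finite set `S(e, c, A) ∋ 2` of rational primes (`DeC.exists_badPrimes`) such that for every number
field `L ⊇ K`, every finite set `T ⊇ S` of primes, every point `(r, s, t)` of `D_e` over `L` with `t = t_c`,
`N = N_c ≠ 0`, every finite `B ⊇ A` with `t ∉ B`, every finite set `W` of places meeting `B` off the
places over `T`, given the converse direction at `A` off `T` (`hconvA`), SEPARATION AT 2 (`hsep2`), the
DEFECT inequality at every `p ∈ T`, `p ≠ 2` (`hδ`), the archimedean bound and the height inputs, the
conductor slope holds with the constants displayed in the module docstring.
[cite: MochizukiGenEll2010, Prop 1.6 p.10] -/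
theorem DeC.slope_of_crit_sep_two_defect (k : ℕ) {c : K} (hc : c ≠ 0) (A : Finset K) :
    ∃ S : Finset ℕ, 2 ∈ S ∧ (∀ p ∈ S, p.Prime) ∧
      ∀ (L : Type u) [Field L] [NumberField L] [Algebra K L] (T : Finset ℕ), S ⊆ T →
        (∀ p ∈ T, p.Prime) →
        ∀ {r s t N x : L},
        s ^ 2 = 1 - 4 * r ^ (2 * k + 1) → t * (r * s) = s + algebraMap K L c * r ^ (k + 2) →
        N = -s ^ 3 + algebraMap K L c * ((k + 1) * r ^ (k + 2) - 2 * r ^ (3 * k + 3)) → N ≠ 0 →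
        ∀ (B : Finset L), A.map ⟨algebraMap K L, (algebraMap K L).injective⟩ ⊆ B →
        (∀ b ∈ B, t ≠ b) →
        ∀ (W : Finset (HeightOneSpectrum (𝓞 L))) (k₂ : ℕ) (Dp : ℕ → ℕ) {C₃ C₄ C₅ C₆ : ℝ},
        (∀ w : HeightOneSpectrum (𝓞 L), w ∉ T.attach.biUnion (fun p => placesOver L p.1) →
          w.valuation L N < 1 →
            ∃ a ∈ A.map ⟨algebraMap K L, (algebraMap K L).injective⟩, w.valuation L (t - a) < 1) →
        (∀ w ∈ W, w ∉ T.attach.biUnion (fun p => placesOver L p.1) → ∃ b ∈ B, 0 < ord L w (t - b)) →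
        (∀ σ : L →+* PadicAlgCl 2, ((2 : ℝ) ^ k₂)⁻¹ ≤ ‖σ N‖) →
        (∀ p ∈ T, p ≠ 2 → ∀ w ∈ placesOver L p,
          (ord L w N).toNat ≤ (∑ b ∈ B, (ord L w (t - b)).toNat) + Dp p * ramIdx L w) →
        (∀ v : InfinitePlace L, Real.posLog (v N⁻¹) ≤ C₃) →
        ((2 * k + 1 : ℝ) * Height.logHeight₁ t ≤
          (2 * k + 4 : ℝ) * Height.logHeight₁ x + Module.finrank ℚ L * C₄) →
        ((6 * k + 6 : ℝ) * Height.logHeight₁ x ≤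
          (2 * k + 1 : ℝ) * Height.logHeight₁ N + Module.finrank ℚ L * C₅) →
        (∀ b ∈ B, Height.logHeight₁ b ≤ Module.finrank ℚ L * C₆) →
        (Module.finrank ℚ L : ℝ)⁻¹ * ∑ w ∈ W, logNorm L w ≤
          ((B.card * (2 * k + 4 : ℝ) - (6 * k + 6)) / (2 * k + 1)) *
              ((Module.finrank ℚ L : ℝ)⁻¹ * Height.logHeight₁ x) +
            ((B.card * C₄ + C₅) / (2 * k + 1) + B.card * (C₆ + Real.log 2) +
              ((k₂ : ℝ) * Real.log 2 + ∑ p ∈ T.erase 2, (Dp p : ℝ) * Real.log p) +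
              (Real.log 2 + ∑ p ∈ T.erase 2, Real.log p) + C₃) := by
  obtain ⟨S, h2S, hSp, hS⟩ := DeC.exists_badPrimes (K := K) k hc A
  refine ⟨S, h2S, hSp, ?_⟩
  intro L _ _ _ T hST hT r s t N x hcurve ht hN hN0 B hAB htB W k₂ Dp C₃ C₄ C₅ C₆ hconvA hW hsep2 hδ
    harch htH hNH hBH
  set ι : K ↪ L := ⟨algebraMap K L, (algebraMap K L).injective⟩ with hι
  have hmono : ∀ w : HeightOneSpectrum (𝓞 L), w ∉ T.attach.biUnion (fun p => placesOver L p.1) →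
      w ∉ S.attach.biUnion (fun p => placesOver L p.1) := by
    intro w hw hwS
    obtain ⟨p, -, hp⟩ := Finset.mem_biUnion.mp hwS
    exact hw (Finset.mem_biUnion.mpr ⟨⟨p.1, hST p.2⟩, Finset.mem_attach _ _, hp⟩)
  refine DeC.inv_finrank_mul_sum_logNorm_le_slope_of_crit_sep_two_defect k hcurve ht hN hN0 (A.map ι) B
    hAB htB
    (fun d => C ((algebraMap K L c) ^ 2) * X ^ (2 * k + 4) + C (4 * d ^ 2) * X ^ (2 * k + 3)
      - C (8 * d) * X ^ (2 * k + 2) + C 4 * X ^ (2 * k + 1) - C (d ^ 2) * X ^ 2 + C (2 * d) * X - 1)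
    (fun _ _ => rfl) T (hST h2S) hT W k₂ Dp ?_ ?_ ?_ ?_ hconvA hW hsep2 hδ harch htH hNH hBH
  · intro w hw
    exact (hS L w (hmono w hw)).1
  · intro w hw
    exact (hS L w (hmono w hw)).2.1
  · intro w hw a ha
    obtain ⟨a₀, ha₀, rfl⟩ := Finset.mem_map.mp ha
    exact (hS L w (hmono w hw)).2.2.1 a₀ ha₀
  · intro w hw a ha ρ hρ hg0 hlt
    obtain ⟨a₀, ha₀, rfl⟩ := Finset.mem_map.mp ha
    exact (hS L w (hmono w hw)).2.2.2.2 a₀ ha₀ _ rfl ρ hρ hg0 hlt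


open scoped Classical in
/-- **General-weight variant** of `DeC.slope_of_crit_sep_two_defect`: the defect at the places over
`T ∖ {2}` is an arbitrary weight `D(w)` with the single summed bound `Σ D(w)·log N(w) ≤ n·C₁`.
[cite: MochizukiGenEll2010, Prop 1.6 p.10] -/
theorem DeC.slope_of_crit_sep_two_defect' (k : ℕ) {c : K} (hc : c ≠ 0) (A : Finset K) :
    ∃ S : Finset ℕ, 2 ∈ S ∧ (∀ p ∈ S, p.Prime) ∧
      ∀ (L : Type u) [Field L] [NumberField L] [Algebra K L] (T : Finset ℕ), S ⊆ T →
        (∀ p ∈ T, p.Prime) →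
        ∀ {r s t N x : L},
        s ^ 2 = 1 - 4 * r ^ (2 * k + 1) → t * (r * s) = s + algebraMap K L c * r ^ (k + 2) →
        N = -s ^ 3 + algebraMap K L c * ((k + 1) * r ^ (k + 2) - 2 * r ^ (3 * k + 3)) → N ≠ 0 →
        ∀ (B : Finset L), A.map ⟨algebraMap K L, (algebraMap K L).injective⟩ ⊆ B →
        (∀ b ∈ B, t ≠ b) →
        ∀ (W : Finset (HeightOneSpectrum (𝓞 L))) (k₂ : ℕ) (D : HeightOneSpectrum (𝓞 L) → ℕ)
          {C₁ C₃ C₄ C₅ C₆ : ℝ},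
        (∀ w : HeightOneSpectrum (𝓞 L), w ∉ T.attach.biUnion (fun p => placesOver L p.1) →
          w.valuation L N < 1 →
            ∃ a ∈ A.map ⟨algebraMap K L, (algebraMap K L).injective⟩, w.valuation L (t - a) < 1) →
        (∀ w ∈ W, w ∉ T.attach.biUnion (fun p => placesOver L p.1) → ∃ b ∈ B, 0 < ord L w (t - b)) →
        (∀ σ : L →+* PadicAlgCl 2, ((2 : ℝ) ^ k₂)⁻¹ ≤ ‖σ N‖) →
        (∀ p ∈ T, p ≠ 2 → ∀ w ∈ placesOver L p,
          (ord L w N).toNat ≤ (∑ b ∈ B, (ord L w (t - b)).toNat) + D w) →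
        (∑ w ∈ (T.erase 2).attach.biUnion (fun p => placesOver L p.1), (D w : ℝ) * logNorm L w ≤
          Module.finrank ℚ L * C₁) →
        (∀ v : InfinitePlace L, Real.posLog (v N⁻¹) ≤ C₃) →
        ((2 * k + 1 : ℝ) * Height.logHeight₁ t ≤
          (2 * k + 4 : ℝ) * Height.logHeight₁ x + Module.finrank ℚ L * C₄) →
        ((6 * k + 6 : ℝ) * Height.logHeight₁ x ≤
          (2 * k + 1 : ℝ) * Height.logHeight₁ N + Module.finrank ℚ L * C₅) →
        (∀ b ∈ B, Height.logHeight₁ b ≤ Module.finrank ℚ L * C₆) →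
        (Module.finrank ℚ L : ℝ)⁻¹ * ∑ w ∈ W, logNorm L w ≤
          ((B.card * (2 * k + 4 : ℝ) - (6 * k + 6)) / (2 * k + 1)) *
              ((Module.finrank ℚ L : ℝ)⁻¹ * Height.logHeight₁ x) +
            ((B.card * C₄ + C₅) / (2 * k + 1) + B.card * (C₆ + Real.log 2) +
              ((k₂ : ℝ) * Real.log 2 + C₁) + (Real.log 2 + ∑ p ∈ T.erase 2, Real.log p) + C₃) := by
  obtain ⟨S, h2S, hSp, hS⟩ := DeC.exists_badPrimes (K := K) k hc A
  refine ⟨S, h2S, hSp, ?_⟩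
  intro L _ _ _ T hST hT r s t N x hcurve ht hN hN0 B hAB htB W k₂ D C₁ C₃ C₄ C₅ C₆ hconvA hW hsep2 hδ hD
    harch htH hNH hBH
  set ι : K ↪ L := ⟨algebraMap K L, (algebraMap K L).injective⟩ with hι
  have hmono : ∀ w : HeightOneSpectrum (𝓞 L), w ∉ T.attach.biUnion (fun p => placesOver L p.1) →
      w ∉ S.attach.biUnion (fun p => placesOver L p.1) := by
    intro w hw hwS
    obtain ⟨p, -, hp⟩ := Finset.mem_biUnion.mp hwS
    exact hw (Finset.mem_biUnion.mpr ⟨⟨p.1, hST p.2⟩, Finset.mem_attach _ _, hp⟩)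
  refine DeC.inv_finrank_mul_sum_logNorm_le_slope_of_crit_sep_two_defect' k hcurve ht hN hN0 (A.map ι) B
    hAB htB
    (fun d => C ((algebraMap K L c) ^ 2) * X ^ (2 * k + 4) + C (4 * d ^ 2) * X ^ (2 * k + 3)
      - C (8 * d) * X ^ (2 * k + 2) + C 4 * X ^ (2 * k + 1) - C (d ^ 2) * X ^ 2 + C (2 * d) * X - 1)
    (fun _ _ => rfl) T (hST h2S) hT W k₂ D ?_ ?_ ?_ ?_ hconvA hW hsep2 hδ hD harch htH hNH hBH
  · intro w hw
    exact (hS L w (hmono w hw)).1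
  · intro w hw
    exact (hS L w (hmono w hw)).2.1
  · intro w hw a ha
    obtain ⟨a₀, ha₀, rfl⟩ := Finset.mem_map.mp ha
    exact (hS L w (hmono w hw)).2.2.1 a₀ ha₀
  · intro w hw a ha ρ hρ hg0 hlt
    obtain ⟨a₀, ha₀, rfl⟩ := Finset.mem_map.mp ha
    exact (hS L w (hmono w hw)).2.2.2.2 a₀ ha₀ _ rfl ρ hρ hg0 hlt

end Literature.NumberTheory.DiophantineGeometry.GenEll
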